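import Literature.MeasureTheory.Group.InvariantQuotientOrbitSublevelTransport                -- §1 (LH3-p03 (g2)): `exists_measure_setOf_descConj_comp_le_rpow_of_conj` (generic transport)
import Literature.NumberTheory.Rogawski1990.ArchUnitaryThreeRegularEllipticClass             -- ★ p849192 LH2-p01 (g3): (α″) `exists_conj_eq_compactTorusRep₃_of_separable_of_norm_root_eq_one`, (Z′) `compactSpace_centralizer_of_coe_eq_compactTorusRep₃`, `isClosed_unitaryGroupOfForm_antidiag_three`
import Literature.NumberTheory.Rogawski1990.ArchEllipticOrbitGroupGrowthThree                -- ★ p849151 LH2-p02 (g2): (E′) `quotientMeasure_setOf_hs_conj_le_linear_of_quadratic_growth`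
import Literature.NumberTheory.Rogawski1990.ArchUnitaryThreeHaarHSBall                      -- ★ p849112 LH2-p01 (g3): (T3-out-G) `haar_unitaryGroupOfForm_antidiag_three_hsBall_le_quadratic`
import Literature.NumberTheory.Rogawski1990.ArchUnitaryThreeRegularHyperbolicClass           -- ★ p849262 LH2-p01 (g3): (α‴) `exists_conj_eq_diagonal_of_separable_of_exists_norm_root_ne_one`
import Literature.NumberTheory.Rogawski1990.ArchHyperbolicOrbitMeasureThree                  -- ★ p849356 LH2-p03 (g3): (H′-ball) `quotientMeasure_hsOrbitBall_le_linear_of_diag_hyperbolic` — ED. 2 (discharges `hHball`)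
import Literature.NumberTheory.Rogawski1990.LocalTransfer                                  -- ★ `IsRegularElt`, `isRegularElt_conj_iff`
import Literature.NumberTheory.Automorphic.UnitaryFormGroupUnimodular                       -- ★ `locallyCompactSpace∕secondCountableTopology_unitaryGroupOfForm_complex`, `modularCharacterFun_unitaryGroupOfForm_eq_one`
import Literature.NumberTheory.Automorphic.GLnAdelicIntegrationFactsProofs                 -- ★ `isMulRightInvariant_of_modularCharacterFun_eq_one`
import Literature.NumberTheory.Automorphic.GLnIwasawaIntegration                           -- ★ `isInvInvariant_of_isMulRightInvariant`
import Literature.NumberTheory.Automorphic.OrbitalMeasureFamilyRegular                     -- ★ `commute_of_charpoly_separable`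
import Literature.NumberTheory.Automorphic.LocalOrbitalMeasure                             -- ★ `isClosed_coe_centralizer_singleton`
import Literature.MeasureTheory.Group.InvariantQuotientAbelian                             -- ★ `isInvInvariant_of_comm`
import Literature.MeasureTheory.Group.InvariantQuotientExistence                           -- ★ `quotientMeasure`, `smulInvariantMeasure_quotientMeasure`, `quotientMeasure_ne_zero`
import HarnessLib

/-!
# The orbit HS-ball quotient-volume token at EVERY regular class of `U(2,1) = U(Φ₃)(ℂ)`, for any carrier and any invariant Radon measure
# (the per-place input of ★ p849184; Beuzart-Plessis 2020 §1.2, §1.8; Rogawski 1990 §3.6)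

Topic `NumberTheory/Rogawski1990`; namespace `Literature.NumberTheory.Rogawski1990`.  THEOREMS ONLY (no `def`, no instance, no notation, no axiom, no named fact, no
`sorry`).  Cell `pub/hodgecm-mathlib`, crux H413 (`stmt-HodgeConjecture-24833`), F0∕P3c line LH2 (closer stub `stub_N8`; letters O1″ [Shelstad1979 Thm. 4.1] ∕ O3″
[Bouaziz1994 Thm. 6.2.1 (i)] about ★ `ArchSchwartzOn L 3 Φ₃ 1`); seat LH3-p03 (g2), deal «(TOT-G)» of LH2-plan (g0) 2026-09-02T04:40:29Z, §3 of the census.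

THE MATHEMATICS.  MODEL carrier `U := U(Φ₃)(ℂ)` = ★ `unitaryGroupOfForm (starRingEnd ℂ) Φ₃` (`Φ₃` = antidiag(1,1,1), signature (2,1)); radius `HS²(y) = Σ_{ij} |y_{ij}|²`.
For a bicontinuous isomorphism `e : G₀ ≃* U` (e.g. a place carrier `U(Φ₃)_w` of `G_∞ = U(Φ₃)(L⁺ ⊗ ℝ)`, ★ `archLocal`, `Φ₃.map σ_w = Φ₃`), `γ₀ ∈ G₀` with `e γ₀` REGULAR
SEMISIMPLE (separable characteristic polynomial) and ANY `G₀`-invariant Radon measure `μ₀` on `G₀ ⧸ Z(γ₀)`:  `μ₀ {x̄ ∣ HS²(e(x γ₀ x⁻¹)) ≤ R} ≤ C R` for `R ≥ 1`.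
DICHOTOMY on the spectrum of `e γ₀` (stable under `z ↦ z̄⁻¹`): (ell) every eigenvalue unimodular — `e γ₀ = h M(u₀,u₁,u₂) h⁻¹` in `U` ((α″) ★ p849192), `Z(M(u))` compact
((Z′) ★ p849192), and for the Weil quotient of a Haar frame the bound is (E′) ★ p849151 fed by Harish-Chandra's quadratic ball growth (T3-out-G) ★ p849112; (hyp) some
eigenvalue off the circle — `e γ₀ = h diag(α,u,ᾱ⁻¹) h⁻¹` in `U` ((α‴) ★ `ArchUnitaryThreeRegularHyperbolicClass`), and the bound at the representative is the hyperbolic-orbit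
estimate (H′-ball) of LH2-p03 (g3) (typing at the time of writing) — it enters as the HYPOTHESIS `hHball` in its posted token shape (Haar frame, `hκ`∕`hχonto` discharged) and is
replaced by `exact` in ED. 2.  In both cases the passage to `(G₀, γ₀, μ₀)` is the generic transport ★ `exists_measure_setOf_descConj_comp_le_rpow_of_conj` (§1 of the census,
`InvariantQuotientOrbitSublevelTransport`): uniqueness of invariant measures + translation invariance. [BeuzartPlessis2020Asterisque, §1.2 (1.2.2), (1.2.4) p. 21; §1.8 p. 39.]

* `centralizer_comm_of_charpoly_separable_subgroup_GL_three` — in any `Γ ≤ GL₃(ℂ)`, the centraliser of a regular semisimple element is commutative (★ `commute_of_charpoly_separable`);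
* `exists_measure_hsOrbitBall_le_linear_of_norm_root_eq_one` — (ell), ★ only;
* `exists_measure_hsOrbitBall_le_linear_of_exists_norm_root_ne_one` — (hyp), modulo `hHball`;
* `exists_measure_hsOrbitBall_le_linear_of_separable` — the dichotomy (`by_cases`), modulo `hHball`.
ED. 2 (append-only; 2026-09-02, after ★ p849356 (H′-ball) landed): §3′ `exists_measure_hsOrbitBall_le_linear_of_exists_norm_root_ne_one'`,
`exists_measure_hsOrbitBall_le_linear_of_separable'` — the SAME tokens with `hHball` DISCHARGED by ★ `quotientMeasure_hsOrbitBall_le_linear_of_diag_hyperbolic`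
(LH2-p03 (g3)): the per-class token at EVERY regular semisimple class of `U(2,1)` is now hypothesis-free.
HONEST LABEL: HC_CM is proved only modulo the 7 printed citations (2 remaining: hLiu418 = `stmt-HodgeConjecture-24832`, h413 = `stmt-HodgeConjecture-24833`) until rung 0
closes; (VOL)∕(CONV) plumbing, count-neutral (+0∕+0); it pays no organ; books unchanged.

## References
* [BeuzartPlessis2020Asterisque] R. Beuzart-Plessis, *A local trace formula for the Gan–Gross–Prasad conjecture for unitary groups: the archimedean case*,
  Astérisque 418 (2020), §1.2 (1.2.2), (1.2.4) p. 21; §1.5 (1.5.2)–(1.5.3) p. 31; §1.8 p. 39.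
* [Rogawski1990] J. D. Rogawski, *Automorphic Representations of Unitary Groups in Three Variables*, Ann. of Math. Stud. 123 (1990), §1.9 p. 8, §3.1 p. 19, §3.6 p. 31.
* [Knapp1986] A. W. Knapp, *Representation Theory of Semisimple Groups* (1986), Ch. V §3 (Cartan subgroups of `SU(2,1)`).
* [Folland1995] G. B. Folland, *A Course in Abstract Harmonic Analysis* (1995), §2.6 Thm. 2.49.
-/

set_option autoImplicit false

noncomputable section

open MeasureTheory MeasureTheory.Measure Set
open Literature.MeasureTheory.Group Literature.NumberTheory.Automorphic Literature.NumberTheory.Automorphic.UnitaryGroup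
open scoped ENNReal NNReal MatrixGroups Matrix

namespace Literature.NumberTheory.Rogawski1990

/-! ## §3 The per-class token on the MODEL carrier `U(Φ₃)(ℂ)`, for any bicontinuously isomorphic carrier and any invariant Radon measure -/

section Model

variable {G₀ : Type*} [Group G₀] [TopologicalSpace G₀] [IsTopologicalGroup G₀] [LocallyCompactSpace G₀] [SecondCountableTopology G₀] [T2Space G₀]

/-- In a subgroup `Γ ≤ GL₃(ℂ)`, the centraliser of an element with separable characteristic polynomial is commutative (★ `commute_of_charpoly_separable`:
the commutant of a regular semisimple matrix is commutative). [cite: Rogawski1990, §3.1 p. 19] -/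
theorem centralizer_comm_of_charpoly_separable_subgroup_GL_three {Γ : Subgroup (GL (Fin 3) ℂ)} (γ : ↥Γ)
    (hsep : (((γ : GL (Fin 3) ℂ)) : Matrix (Fin 3) (Fin 3) ℂ).charpoly.Separable) :
    ∀ x ∈ Subgroup.centralizer ({γ} : Set ↥Γ), ∀ y ∈ Subgroup.centralizer ({γ} : Set ↥Γ), x * y = y * x := by
  intro x hx y hy
  rw [Subgroup.mem_centralizer_singleton_iff] at hx hy
  have hx' : Commute (((γ : GL (Fin 3) ℂ)) : Matrix (Fin 3) (Fin 3) ℂ) (((x : GL (Fin 3) ℂ)) : Matrix (Fin 3) (Fin 3) ℂ) := by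
    have h := congrArg (fun z : ↥Γ => (((z : GL (Fin 3) ℂ)) : Matrix (Fin 3) (Fin 3) ℂ)) hx
    simp only [Subgroup.coe_mul, Units.val_mul] at h
    exact h.symm
  have hy' : Commute (((γ : GL (Fin 3) ℂ)) : Matrix (Fin 3) (Fin 3) ℂ) (((y : GL (Fin 3) ℂ)) : Matrix (Fin 3) (Fin 3) ℂ) := by
    have h := congrArg (fun z : ↥Γ => (((z : GL (Fin 3) ℂ)) : Matrix (Fin 3) (Fin 3) ℂ)) hy
    simp only [Subgroup.coe_mul, Units.val_mul] at h
    exact h.symm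
  have hc := Literature.LinearAlgebra.Matrix.commute_of_charpoly_separable _ hsep hx' hy'
  exact Subtype.ext (Units.ext (by simpa only [Subgroup.coe_mul, Units.val_mul] using hc.eq))

/-- The squared Hilbert–Schmidt norm `y ↦ Σ_{ij} |y_{ij}|²` is continuous on `U(Φ₃)(ℂ)`. [cite: BeuzartPlessis2020Asterisque, §1.2 p. 21] -/
private theorem continuous_hs_unitaryGroupOfForm_antidiag_three :
    Continuous fun y : ↥(unitaryGroupOfForm (starRingEnd ℂ) (Matrix.of fun i j : Fin 3 => if i.val + j.val + 1 = 3 then (1 : ℂ) else 0)) =>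
      ∑ i : Fin 3, ∑ j : Fin 3, ‖((y : GL (Fin 3) ℂ) : Matrix (Fin 3) (Fin 3) ℂ) i j‖ ^ 2 := by
  have hA : Continuous fun y : ↥(unitaryGroupOfForm (starRingEnd ℂ) (Matrix.of fun i j : Fin 3 => if i.val + j.val + 1 = 3 then (1 : ℂ) else 0)) =>
      ((y : GL (Fin 3) ℂ) : Matrix (Fin 3) (Fin 3) ℂ) := Units.continuous_val.comp continuous_subtype_val
  refine continuous_finsetSum _ fun i _ => continuous_finsetSum _ fun j _ => ?_
  exact (continuous_norm.comp (hA.matrix_elem i j)).pow 2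

/-- `Φ₃ ∈ M₃(ℂ)` is hermitian and has determinant `≠ 0` (read from ★ `antidiagOne_isHermitian` ∕ ★ `isUnit_antidiagOne_det` over `ℚ` through `Rat.castHom`-free literals:
direct `fin_cases`). [cite: Rogawski1990, §1.9 p. 8] -/
private theorem antidiag_three_complex_isHermitian_and_det_ne_zero :
    (Matrix.of fun i j : Fin 3 => if i.val + j.val + 1 = 3 then (1 : ℂ) else 0).IsHermitian ∧
      (Matrix.of fun i j : Fin 3 => if i.val + j.val + 1 = 3 then (1 : ℂ) else 0).det ≠ 0 := by
  constructor
  · show (Matrix.of fun i j : Fin 3 => if i.val + j.val + 1 = 3 then (1 : ℂ) else 0)ᴴ = _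
    ext i j
    fin_cases i <;> fin_cases j <;> simp [Matrix.conjTranspose_apply]
  · have h : (Matrix.of fun i j : Fin 3 => if i.val + j.val + 1 = 3 then (1 : ℂ) else 0) = !![0, 0, 1; 0, 1, 0; 1, 0, 0] := by
      ext i j; fin_cases i <;> fin_cases j <;> rfl
    rw [h, Matrix.det_fin_three]
    simp

/-- **ELLIPTIC CLASSES (★ only).**  Let `e : G₀ ≃* U(Φ₃)(ℂ)` be a bicontinuous isomorphism and `γ₀ ∈ G₀` with `e γ₀` regular semisimple with UNIMODULAR eigenvalues.  Then for
EVERY `G₀`-invariant Radon measure `μ₀` on `G₀ ⧸ Z(γ₀)`: `μ₀ {x̄ ∣ ‖e(x γ₀ x⁻¹)‖²_HS ≤ R} ≤ C R` for `R ≥ 1`.  PROOF: (α″) ★ `exists_conj_eq_compactTorusRep₃_of_separable_of_norm_root_eq_one`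
(`e γ₀ = h M(u₀,u₁,u₂) h⁻¹` in `U(Φ₃)(ℂ)`); the centraliser of `M(u)` is compact (★ `compactSpace_centralizer_of_coe_eq_compactTorusRep₃`); (E′) ★
`quotientMeasure_setOf_hs_conj_le_linear_of_quadratic_growth` for the Weil quotient of a Haar frame, fed by (T3-out-G) ★ `haar_unitaryGroupOfForm_antidiag_three_hsBall_le_quadratic`;
§1 transport. [cite: BeuzartPlessis2020Asterisque, §1.2 (1.2.2), (1.2.4) p. 21; §1.8 p. 39] [cite: Rogawski1990, §3.6 p. 31] [cite: Knapp1986, Ch. V §3] -/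
theorem exists_measure_hsOrbitBall_le_linear_of_norm_root_eq_one
    (e : G₀ ≃* ↥(unitaryGroupOfForm (starRingEnd ℂ) (Matrix.of fun i j : Fin 3 => if i.val + j.val + 1 = 3 then (1 : ℂ) else 0)))
    (he : Continuous e) (hes : Continuous e.symm) (γ₀ : G₀)
    (hsep : ((((e γ₀ : ↥(unitaryGroupOfForm (starRingEnd ℂ) (Matrix.of fun i j : Fin 3 => if i.val + j.val + 1 = 3 then (1 : ℂ) else 0))) : GL (Fin 3) ℂ)) :
      Matrix (Fin 3) (Fin 3) ℂ).charpoly.Separable)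
    (hunit : ∀ z : ℂ, ((((e γ₀ : ↥(unitaryGroupOfForm (starRingEnd ℂ) (Matrix.of fun i j : Fin 3 => if i.val + j.val + 1 = 3 then (1 : ℂ) else 0))) : GL (Fin 3) ℂ)) :
      Matrix (Fin 3) (Fin 3) ℂ).charpoly.IsRoot z → ‖z‖ = 1)
    [MeasurableSpace (G₀ ⧸ Subgroup.centralizer ({γ₀} : Set G₀))] [BorelSpace (G₀ ⧸ Subgroup.centralizer ({γ₀} : Set G₀))]
    (μ₀ : Measure (G₀ ⧸ Subgroup.centralizer ({γ₀} : Set G₀))) [SMulInvariantMeasure G₀ (G₀ ⧸ Subgroup.centralizer ({γ₀} : Set G₀)) μ₀] [IsFiniteMeasureOnCompacts μ₀] :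
    ∃ C : ℝ, ∀ R : ℝ, 1 ≤ R →
      μ₀ {x | descConj γ₀ (Subgroup.centralizer ({γ₀} : Set G₀)) (centralizer_comm γ₀)
        (fun y : G₀ => ∑ i : Fin 3, ∑ j : Fin 3,
          ‖(((e y : ↥(unitaryGroupOfForm (starRingEnd ℂ) (Matrix.of fun i j : Fin 3 => if i.val + j.val + 1 = 3 then (1 : ℂ) else 0))) : GL (Fin 3) ℂ) :
            Matrix (Fin 3) (Fin 3) ℂ) i j‖ ^ 2) x ≤ R} ≤ ENNReal.ofReal (C * R ^ (1 : ℝ)) := by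
  classical
  -- instances on the model carrier
  haveI : LocallyCompactSpace ↥(unitaryGroupOfForm (starRingEnd ℂ) (Matrix.of fun i j : Fin 3 => if i.val + j.val + 1 = 3 then (1 : ℂ) else 0)) :=
    locallyCompactSpace_unitaryGroupOfForm_complex _
  haveI : SecondCountableTopology ↥(unitaryGroupOfForm (starRingEnd ℂ) (Matrix.of fun i j : Fin 3 => if i.val + j.val + 1 = 3 then (1 : ℂ) else 0)) :=
    secondCountableTopology_unitaryGroupOfForm_complex _
  letI : MeasurableSpace ↥(unitaryGroupOfForm (starRingEnd ℂ) (Matrix.of fun i j : Fin 3 => if i.val + j.val + 1 = 3 then (1 : ℂ) else 0)) := borel _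
  haveI : BorelSpace ↥(unitaryGroupOfForm (starRingEnd ℂ) (Matrix.of fun i j : Fin 3 => if i.val + j.val + 1 = 3 then (1 : ℂ) else 0)) := ⟨rfl⟩
  -- (α″): the compact-Cartan representative
  obtain ⟨h, γ, u₀, u₁, u₂, h₀, h₁, h₂, -, h₀₂, h₁₂, hγ, hconj⟩ :=
    exists_conj_eq_compactTorusRep₃_of_separable_of_norm_root_eq_one (e γ₀).2 hsep hunit
  have hconj' : e γ₀ = h * γ * h⁻¹ := by
    rw [← hconj]
  -- `γ` is regular too
  have hsepγ : (((γ : GL (Fin 3) ℂ)) : Matrix (Fin 3) (Fin 3) ℂ).charpoly.Separable := by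
    have h2 : (γ : GL (Fin 3) ℂ) = ((h : GL (Fin 3) ℂ))⁻¹ *
        ((e γ₀ : ↥(unitaryGroupOfForm (starRingEnd ℂ) (Matrix.of fun i j : Fin 3 => if i.val + j.val + 1 = 3 then (1 : ℂ) else 0))) : GL (Fin 3) ℂ) *
          (((h : GL (Fin 3) ℂ))⁻¹)⁻¹ := by
      rw [inv_inv, hconj', Subgroup.coe_mul, Subgroup.coe_mul, Subgroup.coe_inv]
      group
    have h3 : IsRegularElt (γ : GL (Fin 3) ℂ) := by
      rw [h2]
      exact (isRegularElt_conj_iff _ _).2 hsep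
    exact h3
  -- a Haar frame: `ν` on `U(Φ₃)(ℂ)` (right-invariant: unimodular) and `t` on the compact abelian centraliser `Z(γ)` (inversion-invariant)
  obtain ⟨hHC, hdC⟩ := antidiag_three_complex_isHermitian_and_det_ne_zero
  let ν : Measure ↥(unitaryGroupOfForm (starRingEnd ℂ) (Matrix.of fun i j : Fin 3 => if i.val + j.val + 1 = 3 then (1 : ℂ) else 0)) :=
    Measure.haarMeasure (Classical.arbitrary _)
  haveI : ν.IsMulRightInvariant := isMulRightInvariant_of_modularCharacterFun_eq_one (modularCharacterFun_unitaryGroupOfForm_eq_one hHC hdC) ν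
  have hZc := Literature.NumberTheory.Automorphic.isClosed_coe_centralizer_singleton γ
  haveI : CompactSpace ↥(Subgroup.centralizer ({γ} : Set ↥(unitaryGroupOfForm (starRingEnd ℂ)
      (Matrix.of fun i j : Fin 3 => if i.val + j.val + 1 = 3 then (1 : ℂ) else 0)))) :=
    compactSpace_centralizer_of_coe_eq_compactTorusRep₃ le_rfl isClosed_unitaryGroupOfForm_antidiag_three h₀ h₁ h₂ h₀₂ h₁₂ hγ
  haveI : LocallyCompactSpace ↥(Subgroup.centralizer ({γ} : Set ↥(unitaryGroupOfForm (starRingEnd ℂ)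
      (Matrix.of fun i j : Fin 3 => if i.val + j.val + 1 = 3 then (1 : ℂ) else 0)))) := hZc.isClosedEmbedding_subtypeVal.locallyCompactSpace
  let t : Measure ↥(Subgroup.centralizer ({γ} : Set ↥(unitaryGroupOfForm (starRingEnd ℂ)
      (Matrix.of fun i j : Fin 3 => if i.val + j.val + 1 = 3 then (1 : ℂ) else 0)))) := Measure.haarMeasure (Classical.arbitrary _)
  haveI : t.IsInvInvariant := isInvInvariant_of_comm _ hZc (centralizer_comm_of_charpoly_separable_subgroup_GL_three γ hsepγ) t
  letI : MeasurableSpace (↥(unitaryGroupOfForm (starRingEnd ℂ) (Matrix.of fun i j : Fin 3 => if i.val + j.val + 1 = 3 then (1 : ℂ) else 0)) ⧸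
      Subgroup.centralizer ({γ} : Set ↥(unitaryGroupOfForm (starRingEnd ℂ) (Matrix.of fun i j : Fin 3 => if i.val + j.val + 1 = 3 then (1 : ℂ) else 0)))) := borel _
  haveI : BorelSpace (↥(unitaryGroupOfForm (starRingEnd ℂ) (Matrix.of fun i j : Fin 3 => if i.val + j.val + 1 = 3 then (1 : ℂ) else 0)) ⧸
      Subgroup.centralizer ({γ} : Set ↥(unitaryGroupOfForm (starRingEnd ℂ) (Matrix.of fun i j : Fin 3 => if i.val + j.val + 1 = 3 then (1 : ℂ) else 0)))) := ⟨rfl⟩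
  -- (E′) fed by (T3-out-G): the bound for the Weil quotient measure at the representative
  obtain ⟨C, hC⟩ := quotientMeasure_setOf_hs_conj_le_linear_of_quadratic_growth (fun _ hg => mem_unitaryGroupOfForm_iff.mp hg) ν h₀ h₁ h₂ h₀₂ h₁₂ γ hγ hZc t
    (haar_unitaryGroupOfForm_antidiag_three_hsBall_le_quadratic ν)
  -- §1 transport to `(G₀, γ₀, μ₀)`
  haveI : SMulInvariantMeasure ↥(unitaryGroupOfForm (starRingEnd ℂ) (Matrix.of fun i j : Fin 3 => if i.val + j.val + 1 = 3 then (1 : ℂ) else 0)) _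
      (quotientMeasure _ t hZc ν) := smulInvariantMeasure_quotientMeasure _ _ _ _
  exact exists_measure_setOf_descConj_comp_le_rpow_of_conj e he hes h hconj' _ continuous_hs_unitaryGroupOfForm_antidiag_three
    (quotientMeasure _ t hZc ν) (quotientMeasure_ne_zero _ _ _ _) μ₀ ⟨C, hC⟩

/-- **HYPERBOLIC CLASSES, modulo (H′-ball).**  Let `e : G₀ ≃* U(Φ₃)(ℂ)` be bicontinuous and `γ₀ ∈ G₀` with `e γ₀` regular semisimple with SOME non-unimodular eigenvalue.
IF the hyperbolic-orbit estimate (H′-ball) holds at the diagonal representatives `diag(α, u, ᾱ⁻¹)` (`|u| = 1 ≠ |α|`) for the Weil quotients of Haar frames — the hypothesis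
`hHball`, LH2-p03 (g3)'s head in its posted shape — THEN for EVERY `G₀`-invariant Radon `μ₀` on `G₀ ⧸ Z(γ₀)`: `μ₀ {x̄ ∣ ‖e(x γ₀ x⁻¹)‖²_HS ≤ R} ≤ C R` for `R ≥ 1`.
PROOF: (α‴) ★ `exists_conj_eq_diagonal_of_separable_of_exists_norm_root_ne_one`, a Haar frame (unimodularity ★ `modularCharacterFun_unitaryGroupOfForm_eq_one`; `Z` abelian), `hHball`, §1.
[cite: BeuzartPlessis2020Asterisque, §1.2 (1.2.2), (1.2.4) p. 21; §1.8 p. 39] [cite: Rogawski1990, §3.6 p. 31] -/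
theorem exists_measure_hsOrbitBall_le_linear_of_exists_norm_root_ne_one
    (e : G₀ ≃* ↥(unitaryGroupOfForm (starRingEnd ℂ) (Matrix.of fun i j : Fin 3 => if i.val + j.val + 1 = 3 then (1 : ℂ) else 0)))
    (he : Continuous e) (hes : Continuous e.symm) (γ₀ : G₀)
    (hsep : ((((e γ₀ : ↥(unitaryGroupOfForm (starRingEnd ℂ) (Matrix.of fun i j : Fin 3 => if i.val + j.val + 1 = 3 then (1 : ℂ) else 0))) : GL (Fin 3) ℂ)) :
      Matrix (Fin 3) (Fin 3) ℂ).charpoly.Separable)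
    (hnu : ∃ z : ℂ, ((((e γ₀ : ↥(unitaryGroupOfForm (starRingEnd ℂ) (Matrix.of fun i j : Fin 3 => if i.val + j.val + 1 = 3 then (1 : ℂ) else 0))) : GL (Fin 3) ℂ)) :
      Matrix (Fin 3) (Fin 3) ℂ).charpoly.IsRoot z ∧ ‖z‖ ≠ 1)
    (hHball : ∀ [LocallyCompactSpace ↥(unitaryGroupOfForm (starRingEnd ℂ) (Matrix.of fun i j : Fin 3 => if i.val + j.val + 1 = 3 then (1 : ℂ) else 0))]
      [SecondCountableTopology ↥(unitaryGroupOfForm (starRingEnd ℂ) (Matrix.of fun i j : Fin 3 => if i.val + j.val + 1 = 3 then (1 : ℂ) else 0))]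
      [MeasurableSpace ↥(unitaryGroupOfForm (starRingEnd ℂ) (Matrix.of fun i j : Fin 3 => if i.val + j.val + 1 = 3 then (1 : ℂ) else 0))]
      [BorelSpace ↥(unitaryGroupOfForm (starRingEnd ℂ) (Matrix.of fun i j : Fin 3 => if i.val + j.val + 1 = 3 then (1 : ℂ) else 0))]
      (γ : ↥(unitaryGroupOfForm (starRingEnd ℂ) (Matrix.of fun i j : Fin 3 => if i.val + j.val + 1 = 3 then (1 : ℂ) else 0))) (α u : ℂ),
      ((γ : GL (Fin 3) ℂ) : Matrix (Fin 3) (Fin 3) ℂ) = !![α, 0, 0; 0, u, 0; 0, 0, (star α)⁻¹] → ‖u‖ = 1 → ‖α‖ ≠ 1 →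
      ∀ (ν : Measure ↥(unitaryGroupOfForm (starRingEnd ℂ) (Matrix.of fun i j : Fin 3 => if i.val + j.val + 1 = 3 then (1 : ℂ) else 0)))
        [ν.IsHaarMeasure] [ν.IsMulRightInvariant] [ν.IsInvInvariant]
        (ρ : Measure ↥(Subgroup.centralizer ({γ} : Set ↥(unitaryGroupOfForm (starRingEnd ℂ) (Matrix.of fun i j : Fin 3 => if i.val + j.val + 1 = 3 then (1 : ℂ) else 0)))))
        [ρ.IsHaarMeasure] [ρ.IsInvInvariant]
        [MeasurableSpace (↥(unitaryGroupOfForm (starRingEnd ℂ) (Matrix.of fun i j : Fin 3 => if i.val + j.val + 1 = 3 then (1 : ℂ) else 0)) ⧸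
          Subgroup.centralizer ({γ} : Set ↥(unitaryGroupOfForm (starRingEnd ℂ) (Matrix.of fun i j : Fin 3 => if i.val + j.val + 1 = 3 then (1 : ℂ) else 0))))]
        [BorelSpace (↥(unitaryGroupOfForm (starRingEnd ℂ) (Matrix.of fun i j : Fin 3 => if i.val + j.val + 1 = 3 then (1 : ℂ) else 0)) ⧸
          Subgroup.centralizer ({γ} : Set ↥(unitaryGroupOfForm (starRingEnd ℂ) (Matrix.of fun i j : Fin 3 => if i.val + j.val + 1 = 3 then (1 : ℂ) else 0))))],
      ∃ C : ℝ, ∀ R : ℝ, 1 ≤ R →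
        quotientMeasure (Subgroup.centralizer ({γ} : Set ↥(unitaryGroupOfForm (starRingEnd ℂ) (Matrix.of fun i j : Fin 3 => if i.val + j.val + 1 = 3 then (1 : ℂ) else 0)))) ρ (Literature.NumberTheory.Automorphic.isClosed_coe_centralizer_singleton γ) ν
          {x | descConj γ (Subgroup.centralizer ({γ} : Set ↥(unitaryGroupOfForm (starRingEnd ℂ) (Matrix.of fun i j : Fin 3 => if i.val + j.val + 1 = 3 then (1 : ℂ) else 0)))) (fun _ h => Subgroup.mem_centralizer_singleton_iff.1 h)
            (fun y : ↥(unitaryGroupOfForm (starRingEnd ℂ) (Matrix.of fun i j : Fin 3 => if i.val + j.val + 1 = 3 then (1 : ℂ) else 0)) =>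
              ∑ i : Fin 3, ∑ j : Fin 3, ‖((y : GL (Fin 3) ℂ) : Matrix (Fin 3) (Fin 3) ℂ) i j‖ ^ 2) x ≤ R} ≤ ENNReal.ofReal (C * R))
    [MeasurableSpace (G₀ ⧸ Subgroup.centralizer ({γ₀} : Set G₀))] [BorelSpace (G₀ ⧸ Subgroup.centralizer ({γ₀} : Set G₀))]
    (μ₀ : Measure (G₀ ⧸ Subgroup.centralizer ({γ₀} : Set G₀))) [SMulInvariantMeasure G₀ (G₀ ⧸ Subgroup.centralizer ({γ₀} : Set G₀)) μ₀] [IsFiniteMeasureOnCompacts μ₀] :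
    ∃ C : ℝ, ∀ R : ℝ, 1 ≤ R →
      μ₀ {x | descConj γ₀ (Subgroup.centralizer ({γ₀} : Set G₀)) (centralizer_comm γ₀)
        (fun y : G₀ => ∑ i : Fin 3, ∑ j : Fin 3,
          ‖(((e y : ↥(unitaryGroupOfForm (starRingEnd ℂ) (Matrix.of fun i j : Fin 3 => if i.val + j.val + 1 = 3 then (1 : ℂ) else 0))) : GL (Fin 3) ℂ) :
            Matrix (Fin 3) (Fin 3) ℂ) i j‖ ^ 2) x ≤ R} ≤ ENNReal.ofReal (C * R ^ (1 : ℝ)) := by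
  classical
  -- instances on the model carrier
  haveI : LocallyCompactSpace ↥(unitaryGroupOfForm (starRingEnd ℂ) (Matrix.of fun i j : Fin 3 => if i.val + j.val + 1 = 3 then (1 : ℂ) else 0)) :=
    locallyCompactSpace_unitaryGroupOfForm_complex _
  haveI : SecondCountableTopology ↥(unitaryGroupOfForm (starRingEnd ℂ) (Matrix.of fun i j : Fin 3 => if i.val + j.val + 1 = 3 then (1 : ℂ) else 0)) :=
    secondCountableTopology_unitaryGroupOfForm_complex _
  letI : MeasurableSpace ↥(unitaryGroupOfForm (starRingEnd ℂ) (Matrix.of fun i j : Fin 3 => if i.val + j.val + 1 = 3 then (1 : ℂ) else 0)) := borel _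
  haveI : BorelSpace ↥(unitaryGroupOfForm (starRingEnd ℂ) (Matrix.of fun i j : Fin 3 => if i.val + j.val + 1 = 3 then (1 : ℂ) else 0)) := ⟨rfl⟩
  -- (α‴): the diagonal representative
  obtain ⟨h, γ, α, u, -, hα1, hu, hγ, hconj⟩ := exists_conj_eq_diagonal_of_separable_of_exists_norm_root_ne_one (e γ₀).2 hsep hnu
  have hconj' : e γ₀ = h * γ * h⁻¹ := by
    rw [← hconj]
  have hsepγ : (((γ : GL (Fin 3) ℂ)) : Matrix (Fin 3) (Fin 3) ℂ).charpoly.Separable := by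
    have h2 : (γ : GL (Fin 3) ℂ) = ((h : GL (Fin 3) ℂ))⁻¹ *
        ((e γ₀ : ↥(unitaryGroupOfForm (starRingEnd ℂ) (Matrix.of fun i j : Fin 3 => if i.val + j.val + 1 = 3 then (1 : ℂ) else 0))) : GL (Fin 3) ℂ) *
          (((h : GL (Fin 3) ℂ))⁻¹)⁻¹ := by
      rw [inv_inv, hconj', Subgroup.coe_mul, Subgroup.coe_mul, Subgroup.coe_inv]
      group
    have h3 : IsRegularElt (γ : GL (Fin 3) ℂ) := by
      rw [h2]
      exact (isRegularElt_conj_iff _ _).2 hsep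
    exact h3
  -- a Haar frame
  obtain ⟨hHC, hdC⟩ := antidiag_three_complex_isHermitian_and_det_ne_zero
  let ν : Measure ↥(unitaryGroupOfForm (starRingEnd ℂ) (Matrix.of fun i j : Fin 3 => if i.val + j.val + 1 = 3 then (1 : ℂ) else 0)) :=
    Measure.haarMeasure (Classical.arbitrary _)
  haveI : ν.IsMulRightInvariant := isMulRightInvariant_of_modularCharacterFun_eq_one (modularCharacterFun_unitaryGroupOfForm_eq_one hHC hdC) ν
  haveI : ν.IsInvInvariant := isInvInvariant_of_isMulRightInvariant ν
  have hZc := Literature.NumberTheory.Automorphic.isClosed_coe_centralizer_singleton γ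
  haveI : LocallyCompactSpace ↥(Subgroup.centralizer ({γ} : Set ↥(unitaryGroupOfForm (starRingEnd ℂ)
      (Matrix.of fun i j : Fin 3 => if i.val + j.val + 1 = 3 then (1 : ℂ) else 0)))) := hZc.isClosedEmbedding_subtypeVal.locallyCompactSpace
  let t : Measure ↥(Subgroup.centralizer ({γ} : Set ↥(unitaryGroupOfForm (starRingEnd ℂ)
      (Matrix.of fun i j : Fin 3 => if i.val + j.val + 1 = 3 then (1 : ℂ) else 0)))) := Measure.haarMeasure (Classical.arbitrary _)
  haveI : t.IsInvInvariant := isInvInvariant_of_comm _ hZc (centralizer_comm_of_charpoly_separable_subgroup_GL_three γ hsepγ) t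
  letI : MeasurableSpace (↥(unitaryGroupOfForm (starRingEnd ℂ) (Matrix.of fun i j : Fin 3 => if i.val + j.val + 1 = 3 then (1 : ℂ) else 0)) ⧸
      Subgroup.centralizer ({γ} : Set ↥(unitaryGroupOfForm (starRingEnd ℂ) (Matrix.of fun i j : Fin 3 => if i.val + j.val + 1 = 3 then (1 : ℂ) else 0)))) := borel _
  haveI : BorelSpace (↥(unitaryGroupOfForm (starRingEnd ℂ) (Matrix.of fun i j : Fin 3 => if i.val + j.val + 1 = 3 then (1 : ℂ) else 0)) ⧸
      Subgroup.centralizer ({γ} : Set ↥(unitaryGroupOfForm (starRingEnd ℂ) (Matrix.of fun i j : Fin 3 => if i.val + j.val + 1 = 3 then (1 : ℂ) else 0)))) := ⟨rfl⟩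
  -- (H′-ball) at the representative
  obtain ⟨C, hC⟩ := hHball γ α u hγ hu hα1 ν t
  -- §1 transport
  haveI : SMulInvariantMeasure ↥(unitaryGroupOfForm (starRingEnd ℂ) (Matrix.of fun i j : Fin 3 => if i.val + j.val + 1 = 3 then (1 : ℂ) else 0)) _
      (quotientMeasure _ t hZc ν) := smulInvariantMeasure_quotientMeasure _ _ _ _
  refine exists_measure_setOf_descConj_comp_le_rpow_of_conj e he hes h hconj' _ continuous_hs_unitaryGroupOfForm_antidiag_three
    (quotientMeasure _ t hZc ν) (quotientMeasure_ne_zero _ _ _ _) μ₀ ⟨C, fun R hR => ?_⟩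
  rw [Real.rpow_one]
  exact hC R hR

/-- **THE PER-CLASS TOKEN ON THE MODEL CARRIER (dichotomy).**  For `e : G₀ ≃* U(Φ₃)(ℂ)` bicontinuous, `γ₀ ∈ G₀` with `e γ₀` regular semisimple, and EVERY `G₀`-invariant Radon
`μ₀` on `G₀ ⧸ Z(γ₀)`: `μ₀ {x̄ ∣ ‖e(x γ₀ x⁻¹)‖²_HS ≤ R} ≤ C R` (`R ≥ 1`), modulo (H′-ball) (`hHball`) — `by_cases` on «all eigenvalues unimodular» between
`exists_measure_hsOrbitBall_le_linear_of_norm_root_eq_one` (★ only) and `exists_measure_hsOrbitBall_le_linear_of_exists_norm_root_ne_one`.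
[cite: BeuzartPlessis2020Asterisque, §1.8 p. 39; §1.5 (1.5.2)–(1.5.3) p. 31] [cite: Rogawski1990, §3.6 p. 31] -/
theorem exists_measure_hsOrbitBall_le_linear_of_separable
    (e : G₀ ≃* ↥(unitaryGroupOfForm (starRingEnd ℂ) (Matrix.of fun i j : Fin 3 => if i.val + j.val + 1 = 3 then (1 : ℂ) else 0)))
    (he : Continuous e) (hes : Continuous e.symm) (γ₀ : G₀)
    (hsep : ((((e γ₀ : ↥(unitaryGroupOfForm (starRingEnd ℂ) (Matrix.of fun i j : Fin 3 => if i.val + j.val + 1 = 3 then (1 : ℂ) else 0))) : GL (Fin 3) ℂ)) :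
      Matrix (Fin 3) (Fin 3) ℂ).charpoly.Separable)
    (hHball : ∀ [LocallyCompactSpace ↥(unitaryGroupOfForm (starRingEnd ℂ) (Matrix.of fun i j : Fin 3 => if i.val + j.val + 1 = 3 then (1 : ℂ) else 0))]
      [SecondCountableTopology ↥(unitaryGroupOfForm (starRingEnd ℂ) (Matrix.of fun i j : Fin 3 => if i.val + j.val + 1 = 3 then (1 : ℂ) else 0))]
      [MeasurableSpace ↥(unitaryGroupOfForm (starRingEnd ℂ) (Matrix.of fun i j : Fin 3 => if i.val + j.val + 1 = 3 then (1 : ℂ) else 0))]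
      [BorelSpace ↥(unitaryGroupOfForm (starRingEnd ℂ) (Matrix.of fun i j : Fin 3 => if i.val + j.val + 1 = 3 then (1 : ℂ) else 0))]
      (γ : ↥(unitaryGroupOfForm (starRingEnd ℂ) (Matrix.of fun i j : Fin 3 => if i.val + j.val + 1 = 3 then (1 : ℂ) else 0))) (α u : ℂ),
      ((γ : GL (Fin 3) ℂ) : Matrix (Fin 3) (Fin 3) ℂ) = !![α, 0, 0; 0, u, 0; 0, 0, (star α)⁻¹] → ‖u‖ = 1 → ‖α‖ ≠ 1 →
      ∀ (ν : Measure ↥(unitaryGroupOfForm (starRingEnd ℂ) (Matrix.of fun i j : Fin 3 => if i.val + j.val + 1 = 3 then (1 : ℂ) else 0)))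
        [ν.IsHaarMeasure] [ν.IsMulRightInvariant] [ν.IsInvInvariant]
        (ρ : Measure ↥(Subgroup.centralizer ({γ} : Set ↥(unitaryGroupOfForm (starRingEnd ℂ) (Matrix.of fun i j : Fin 3 => if i.val + j.val + 1 = 3 then (1 : ℂ) else 0)))))
        [ρ.IsHaarMeasure] [ρ.IsInvInvariant]
        [MeasurableSpace (↥(unitaryGroupOfForm (starRingEnd ℂ) (Matrix.of fun i j : Fin 3 => if i.val + j.val + 1 = 3 then (1 : ℂ) else 0)) ⧸
          Subgroup.centralizer ({γ} : Set ↥(unitaryGroupOfForm (starRingEnd ℂ) (Matrix.of fun i j : Fin 3 => if i.val + j.val + 1 = 3 then (1 : ℂ) else 0))))]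
        [BorelSpace (↥(unitaryGroupOfForm (starRingEnd ℂ) (Matrix.of fun i j : Fin 3 => if i.val + j.val + 1 = 3 then (1 : ℂ) else 0)) ⧸
          Subgroup.centralizer ({γ} : Set ↥(unitaryGroupOfForm (starRingEnd ℂ) (Matrix.of fun i j : Fin 3 => if i.val + j.val + 1 = 3 then (1 : ℂ) else 0))))],
      ∃ C : ℝ, ∀ R : ℝ, 1 ≤ R →
        quotientMeasure (Subgroup.centralizer ({γ} : Set ↥(unitaryGroupOfForm (starRingEnd ℂ) (Matrix.of fun i j : Fin 3 => if i.val + j.val + 1 = 3 then (1 : ℂ) else 0)))) ρ (Literature.NumberTheory.Automorphic.isClosed_coe_centralizer_singleton γ) ν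
          {x | descConj γ (Subgroup.centralizer ({γ} : Set ↥(unitaryGroupOfForm (starRingEnd ℂ) (Matrix.of fun i j : Fin 3 => if i.val + j.val + 1 = 3 then (1 : ℂ) else 0)))) (fun _ h => Subgroup.mem_centralizer_singleton_iff.1 h)
            (fun y : ↥(unitaryGroupOfForm (starRingEnd ℂ) (Matrix.of fun i j : Fin 3 => if i.val + j.val + 1 = 3 then (1 : ℂ) else 0)) =>
              ∑ i : Fin 3, ∑ j : Fin 3, ‖((y : GL (Fin 3) ℂ) : Matrix (Fin 3) (Fin 3) ℂ) i j‖ ^ 2) x ≤ R} ≤ ENNReal.ofReal (C * R))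
    [MeasurableSpace (G₀ ⧸ Subgroup.centralizer ({γ₀} : Set G₀))] [BorelSpace (G₀ ⧸ Subgroup.centralizer ({γ₀} : Set G₀))]
    (μ₀ : Measure (G₀ ⧸ Subgroup.centralizer ({γ₀} : Set G₀))) [SMulInvariantMeasure G₀ (G₀ ⧸ Subgroup.centralizer ({γ₀} : Set G₀)) μ₀] [IsFiniteMeasureOnCompacts μ₀] :
    ∃ C : ℝ, ∀ R : ℝ, 1 ≤ R →
      μ₀ {x | descConj γ₀ (Subgroup.centralizer ({γ₀} : Set G₀)) (centralizer_comm γ₀)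
        (fun y : G₀ => ∑ i : Fin 3, ∑ j : Fin 3,
          ‖(((e y : ↥(unitaryGroupOfForm (starRingEnd ℂ) (Matrix.of fun i j : Fin 3 => if i.val + j.val + 1 = 3 then (1 : ℂ) else 0))) : GL (Fin 3) ℂ) :
            Matrix (Fin 3) (Fin 3) ℂ) i j‖ ^ 2) x ≤ R} ≤ ENNReal.ofReal (C * R ^ (1 : ℝ)) := by
  by_cases hunit : ∀ z : ℂ, ((((e γ₀ : ↥(unitaryGroupOfForm (starRingEnd ℂ) (Matrix.of fun i j : Fin 3 => if i.val + j.val + 1 = 3 then (1 : ℂ) else 0))) : GL (Fin 3) ℂ)) :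
      Matrix (Fin 3) (Fin 3) ℂ).charpoly.IsRoot z → ‖z‖ = 1
  · exact exists_measure_hsOrbitBall_le_linear_of_norm_root_eq_one e he hes γ₀ hsep hunit μ₀
  · push Not at hunit
    exact exists_measure_hsOrbitBall_le_linear_of_exists_norm_root_ne_one e he hes γ₀ hsep hunit hHball μ₀


/-! ## §3′ (ED. 2) The tokens with `hHball` discharged by ★ p849356 (H′-ball): hypothesis-free at EVERY regular class -/

/-- **HYPERBOLIC CLASSES — UNCONDITIONAL (ED. 2).**  For `e : G₀ ≃* U(Φ₃)(ℂ)` bicontinuous, `γ₀ ∈ G₀` with `e γ₀` regular semisimple with some non-unimodular eigenvalue, and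
EVERY `G₀`-invariant Radon `μ₀` on `G₀ ⧸ Z(γ₀)`: `μ₀ {x̄ ∣ ‖e(x γ₀ x⁻¹)‖²_HS ≤ R} ≤ C R` (`R ≥ 1`) — `exists_measure_hsOrbitBall_le_linear_of_exists_norm_root_ne_one` with `hHball`
:= ★ `quotientMeasure_hsOrbitBall_le_linear_of_diag_hyperbolic` (LH2-p03 (g3), p849356). [cite: BeuzartPlessis2020Asterisque, §1.2 (1.2.2), (1.2.4) p. 21; §1.8 p. 39]
[cite: Rogawski1990, §3.6 p. 31] -/
theorem exists_measure_hsOrbitBall_le_linear_of_exists_norm_root_ne_one'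
    (e : G₀ ≃* ↥(unitaryGroupOfForm (starRingEnd ℂ) (Matrix.of fun i j : Fin 3 => if i.val + j.val + 1 = 3 then (1 : ℂ) else 0)))
    (he : Continuous e) (hes : Continuous e.symm) (γ₀ : G₀)
    (hsep : ((((e γ₀ : ↥(unitaryGroupOfForm (starRingEnd ℂ) (Matrix.of fun i j : Fin 3 => if i.val + j.val + 1 = 3 then (1 : ℂ) else 0))) : GL (Fin 3) ℂ)) :
      Matrix (Fin 3) (Fin 3) ℂ).charpoly.Separable)
    (hnu : ∃ z : ℂ, ((((e γ₀ : ↥(unitaryGroupOfForm (starRingEnd ℂ) (Matrix.of fun i j : Fin 3 => if i.val + j.val + 1 = 3 then (1 : ℂ) else 0))) : GL (Fin 3) ℂ)) :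
      Matrix (Fin 3) (Fin 3) ℂ).charpoly.IsRoot z ∧ ‖z‖ ≠ 1)
    [MeasurableSpace (G₀ ⧸ Subgroup.centralizer ({γ₀} : Set G₀))] [BorelSpace (G₀ ⧸ Subgroup.centralizer ({γ₀} : Set G₀))]
    (μ₀ : Measure (G₀ ⧸ Subgroup.centralizer ({γ₀} : Set G₀))) [SMulInvariantMeasure G₀ (G₀ ⧸ Subgroup.centralizer ({γ₀} : Set G₀)) μ₀] [IsFiniteMeasureOnCompacts μ₀] :
    ∃ C : ℝ, ∀ R : ℝ, 1 ≤ R →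
      μ₀ {x | descConj γ₀ (Subgroup.centralizer ({γ₀} : Set G₀)) (centralizer_comm γ₀)
        (fun y : G₀ => ∑ i : Fin 3, ∑ j : Fin 3,
          ‖(((e y : ↥(unitaryGroupOfForm (starRingEnd ℂ) (Matrix.of fun i j : Fin 3 => if i.val + j.val + 1 = 3 then (1 : ℂ) else 0))) : GL (Fin 3) ℂ) :
            Matrix (Fin 3) (Fin 3) ℂ) i j‖ ^ 2) x ≤ R} ≤ ENNReal.ofReal (C * R ^ (1 : ℝ)) :=
  exists_measure_hsOrbitBall_le_linear_of_exists_norm_root_ne_one e he hes γ₀ hsep hnu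
    (fun _ _ _ hγ hu hα1 ν _ _ _ ρ _ _ _ _ => quotientMeasure_hsOrbitBall_le_linear_of_diag_hyperbolic hγ hu hα1 ν ρ) μ₀

/-- **THE PER-CLASS TOKEN ON THE MODEL CARRIER — UNCONDITIONAL (ED. 2).**  For `e : G₀ ≃* U(Φ₃)(ℂ)` bicontinuous, `γ₀ ∈ G₀` with `e γ₀` REGULAR SEMISIMPLE, and EVERY
`G₀`-invariant Radon `μ₀` on `G₀ ⧸ Z(γ₀)`: `μ₀ {x̄ ∣ ‖e(x γ₀ x⁻¹)‖²_HS ≤ R} ≤ C R` (`R ≥ 1`) — Harish-Chandra's linear orbit growth at every regular class of `U(2,1)`, both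
Cartan types: elliptic ((α″)(Z′)(E′)(T3-out-G), ★ p849192∕p849151∕p849112) and hyperbolic ((α‴)(H′-ball), ★ p849262∕p849356), through the generic transport ★ p849310.
[cite: BeuzartPlessis2020Asterisque, §1.8 p. 39; §1.5 (1.5.2)–(1.5.3) p. 31] [cite: Rogawski1990, §3.6 p. 31] -/
theorem exists_measure_hsOrbitBall_le_linear_of_separable'
    (e : G₀ ≃* ↥(unitaryGroupOfForm (starRingEnd ℂ) (Matrix.of fun i j : Fin 3 => if i.val + j.val + 1 = 3 then (1 : ℂ) else 0)))
    (he : Continuous e) (hes : Continuous e.symm) (γ₀ : G₀)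
    (hsep : ((((e γ₀ : ↥(unitaryGroupOfForm (starRingEnd ℂ) (Matrix.of fun i j : Fin 3 => if i.val + j.val + 1 = 3 then (1 : ℂ) else 0))) : GL (Fin 3) ℂ)) :
      Matrix (Fin 3) (Fin 3) ℂ).charpoly.Separable)
    [MeasurableSpace (G₀ ⧸ Subgroup.centralizer ({γ₀} : Set G₀))] [BorelSpace (G₀ ⧸ Subgroup.centralizer ({γ₀} : Set G₀))]
    (μ₀ : Measure (G₀ ⧸ Subgroup.centralizer ({γ₀} : Set G₀))) [SMulInvariantMeasure G₀ (G₀ ⧸ Subgroup.centralizer ({γ₀} : Set G₀)) μ₀] [IsFiniteMeasureOnCompacts μ₀] :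
    ∃ C : ℝ, ∀ R : ℝ, 1 ≤ R →
      μ₀ {x | descConj γ₀ (Subgroup.centralizer ({γ₀} : Set G₀)) (centralizer_comm γ₀)
        (fun y : G₀ => ∑ i : Fin 3, ∑ j : Fin 3,
          ‖(((e y : ↥(unitaryGroupOfForm (starRingEnd ℂ) (Matrix.of fun i j : Fin 3 => if i.val + j.val + 1 = 3 then (1 : ℂ) else 0))) : GL (Fin 3) ℂ) :
            Matrix (Fin 3) (Fin 3) ℂ) i j‖ ^ 2) x ≤ R} ≤ ENNReal.ofReal (C * R ^ (1 : ℝ)) :=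
  exists_measure_hsOrbitBall_le_linear_of_separable e he hes γ₀ hsep
    (fun _ _ _ hγ hu hα1 ν _ _ _ ρ _ _ _ _ => quotientMeasure_hsOrbitBall_le_linear_of_diag_hyperbolic hγ hu hα1 ν ρ) μ₀

end Model

end Literature.NumberTheory.Rogawski1990

end
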